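import Summits.CriticalPhenomena.PercolationContinuityZ3.Theorems.PercNearOneGluingNoHeavyLowerTailAntitheticUConeInvariance
import HarnessLib

/-!
# `NoHeavyLowerTail` (stmt-CriticalPhenomena-4575) — antithetic cluster pairs: the zone system of THEOREM U — part 4: INVARIANCE
# (prim-hp-2 gen 37; HOME/THEOREM-U-universal.md, cases A, B, C)

Support file (`--supports stmt-CriticalPhenomena-4575`, hull-port prover `prim-hp-2`, gen 37).  No definitions, no named facts, no sorries;
standard axioms.  Setting and rule: `…AntitheticUConeZones`; tools: `…UConeInvariance`.

`UCone.invariance` (hypothesis (invariance) of `zoneSystem_bic_nonneg`): for `T, M` in the constraint set with `M` agreeing with `T` or with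
`Tᶜ` on every zone block of `T`, zones are unchanged and colours equal resp. opposite.  Case A (`inv_red`, red-reached `r`): standard-zone
basics; if `r` becomes unreached then `k₀` was outside the zone and no swallowing appears (`not_sw_red`), so the zone is again the (own = blue)
cluster.  Case B (`inv_sw`, swallowed `r`): the swallower stays reached (path lemma), the hub is unchanged, `r` either becomes reached with
the same zone or stays swallowed.  Case C (`inv_small`): the own cluster is congruent; if `r` becomes reached its zone is that cluster; if it
stays unreached no swallowing appears (`not_sw_small`).  Blue and `Tᶜ`-agreement variants by the colour swaps.
[cite: VandenbergHaggstromKahn2005, §1 p. 3 (open cluster `C_s`)]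
-/

noncomputable section

namespace Summit.CriticalPhenomena.PercolationContinuityZ3.Theorems

open Literature.Probability.Percolation
open scoped Classical symmDiff

namespace Antithetic

namespace UCone

section Invariance

variable {V : Type*} {E : Set (Sym2 V)} {s k₀ : V} {R : Set V} {T M : Set (Sym2 V)}

/-- Agreement with `T` or `Tᶜ` on all blocks, transported to `(Tᶜ, Mᶜ)`. [this work] -/
theorem agree_all_compl
    (hag : ∀ u ∈ R, (∀ e ∈ ZoneSys.blk E (zone E s k₀ R T u), (e ∈ M ↔ e ∈ T)) ∨
      (∀ e ∈ ZoneSys.blk E (zone E s k₀ R T u), (e ∈ M ↔ e ∉ T))) :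
    ∀ u ∈ R, (∀ e ∈ ZoneSys.blk E (zone E s k₀ R Tᶜ u), (e ∈ Mᶜ ↔ e ∈ Tᶜ)) ∨
      (∀ e ∈ ZoneSys.blk E (zone E s k₀ R Tᶜ u), (e ∈ Mᶜ ↔ e ∉ Tᶜ)) := by
  intro u hu
  rw [zone_compl]
  rcases hag u hu with h | h
  · exact Or.inl (ACone.agree_compl_both h)
  · exact Or.inr fun e he => by rw [Set.mem_compl_iff, Set.mem_compl_iff, h e he, not_not]

/-- Agreement with `T` or `Tᶜ` on all blocks, transported to `(T, Mᶜ)`. [this work] -/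
theorem agree_all_compl_right
    (hag : ∀ u ∈ R, (∀ e ∈ ZoneSys.blk E (zone E s k₀ R T u), (e ∈ M ↔ e ∈ T)) ∨
      (∀ e ∈ ZoneSys.blk E (zone E s k₀ R T u), (e ∈ M ↔ e ∉ T))) :
    ∀ u ∈ R, (∀ e ∈ ZoneSys.blk E (zone E s k₀ R T u), (e ∈ Mᶜ ↔ e ∈ T)) ∨
      (∀ e ∈ ZoneSys.blk E (zone E s k₀ R T u), (e ∈ Mᶜ ↔ e ∉ T)) := by
  intro u hu
  rcases hag u hu with h | h
  · exact Or.inr fun e he => by rw [Set.mem_compl_iff, h e he]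
  · exact Or.inl (ACone.agree_compl_left h)

/-- **Case A: invariance for a red-reached vertex** (agreement with `T` on its block). [this work] -/
theorem inv_red (hk : k₀ ≠ s) (huniv : ∀ v, v ≠ k₀ → s(k₀, v) ∈ E)
    (hT : ∀ r ∈ R, ¬ ((openGraph (T ∩ E)).Reachable s r ∧ (openGraph (Tᶜ ∩ E)).Reachable s r))
    (hM : ∀ r ∈ R, ¬ ((openGraph (M ∩ E)).Reachable s r ∧ (openGraph (Mᶜ ∩ E)).Reachable s r))
    (hag : ∀ u ∈ R, (∀ e ∈ ZoneSys.blk E (zone E s k₀ R T u), (e ∈ M ↔ e ∈ T)) ∨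
      (∀ e ∈ ZoneSys.blk E (zone E s k₀ R T u), (e ∈ M ↔ e ∉ T)))
    {r : V} (hrR : r ∈ R) (hq : (openGraph (T ∩ E)).Reachable s r)
    (hagr : ∀ e ∈ ZoneSys.blk E (zone E s k₀ R T r), (e ∈ M ↔ e ∈ T)) :
    zone E s k₀ R M r = zone E s k₀ R T r ∧ r ∈ beta E s k₀ R M := by
  obtain ⟨hcl, hnb, hz⟩ := std_basic (k₀ := k₀) (R := R) (hT r hrR) (hM r hrR) hq hagr
  by_cases hrM : (openGraph (M ∩ E)).Reachable s r
  · exact ⟨hz hrM, beta_of_red hrM⟩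
  · have hk₀ : k₀ ∉ zone E s k₀ R T r := fun h => hrM (reached_of_hubv_mem hk huniv (hT r hrR) hq hagr h)
    have hsw : M ∉ swSet E s k₀ R := not_sw_red hk huniv hT hM hag hrR hq hagr hk₀ hrM hnb
    have hrk : r ≠ k₀ := fun h => hk₀ (h ▸ mem_zone_self)
    have hE : s(r, k₀) ∈ E := by rw [Sym2.eq_swap]; exact huniv r hrk
    have hZ := zone_of_red (k₀ := k₀) (R := R) (hT r hrR) hq
    have hrkT : s(r, k₀) ∈ T := by
      by_contra h
      exact hk₀ (by rw [hZ]; exact ((openGraph_adj (Tᶜ ∩ E) r k₀).2 ⟨⟨h, hE⟩, hrk⟩).reachable)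
    have hrkM : s(r, k₀) ∈ M := (hagr _ (by rw [hZ]; exact ZoneSys.mk_mem_blk hE hrk (Or.inl (mem_openCluster_self _ _)))).2 hrkT
    obtain ⟨-, -, hiffM⟩ := opp_spoke (T := M) hk huniv hrM hnb
    have hskM : s(s, k₀) ∉ M := hiffM.1 hrkM
    refine ⟨by rw [zone_of_small hrM hnb hsw, own_of_blue hskM, hcl, hZ], ?_⟩
    rw [beta_iff_of_none hrM hnb]
    exact iff_of_false hsw hskM

/-- **Case B: invariance for a swallowed vertex** (agreement with `T` on its block). [this work] -/
theorem inv_sw (hk : k₀ ≠ s) (huniv : ∀ v, v ≠ k₀ → s(k₀, v) ∈ E)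
    (hT : ∀ r ∈ R, ¬ ((openGraph (T ∩ E)).Reachable s r ∧ (openGraph (Tᶜ ∩ E)).Reachable s r))
    (hM : ∀ r ∈ R, ¬ ((openGraph (M ∩ E)).Reachable s r ∧ (openGraph (Mᶜ ∩ E)).Reachable s r))
    {r : V} (hrR : r ∈ R) (hr : ¬ (openGraph (T ∩ E)).Reachable s r) (hb : ¬ (openGraph (Tᶜ ∩ E)).Reachable s r)
    (hsw : T ∈ swSet E s k₀ R) (hagr : ∀ e ∈ ZoneSys.blk E (zone E s k₀ R T r), (e ∈ M ↔ e ∈ T)) :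
    zone E s k₀ R M r = zone E s k₀ R T r ∧ (r ∈ beta E s k₀ R M ↔ r ∈ beta E s k₀ R T) := by
  have hZr := zone_of_sw hk huniv hr hb hsw
  obtain ⟨q₁, hq₁R, hq₁T, hZ₁, hk₀Z₁⟩ := exists_swallower hk huniv hT hr hb hsw
  have hag₁ : ∀ e ∈ ZoneSys.blk E (zone E s k₀ R T q₁), (e ∈ M ↔ e ∈ T) := by rw [hZ₁, ← hZr]; exact hagr
  obtain ⟨hz₁, hreach₁⟩ := std_inv hk huniv (hT q₁ hq₁R) (hM q₁ hq₁R) hq₁T (Or.inl hag₁)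
  have hq₁M := hreach₁ hk₀Z₁
  have hZM₁ := hz₁ hq₁M                   -- zone M q₁ = zone T q₁ (= hub T ∋ k₀, r)
  have hrZ₁ : r ∈ zone E s k₀ R T q₁ := by rw [hZ₁, ← hZr]; exact mem_zone_self
  -- the spoke `s k₀` lies in the block: same colour in `M`
  have hsk : s(s, k₀) ∈ E := by rw [Sym2.eq_swap]; exact huniv s hk.symm
  have hskb : s(s, k₀) ∈ ZoneSys.blk E (zone E s k₀ R T r) := by
    rw [hZr, ← hZ₁]; exact ZoneSys.mk_mem_blk hsk hk.symm (Or.inr hk₀Z₁)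
  have hsk_iff : s(s, k₀) ∈ M ↔ s(s, k₀) ∈ T := hagr _ hskb
  have hβT : r ∈ beta E s k₀ R T ↔ s(s, k₀) ∈ T := by rw [beta_iff_of_none hr hb]; exact ⟨fun h => h.1 hsw, fun h => iff_of_true hsw h⟩
  -- the type of `q₁` in `M`: its zone contains `k₀`, which is reached in the colour of the spoke
  obtain ⟨g1, g2⟩ := hubv_reached (T := M) hk huniv
  -- the non-reaching colour cluster of `q₁` in `M` is `hub T`; `r` lies in it
  by_cases hskM : s(s, k₀) ∈ M
  · -- `k₀` red-reached in `M`; `q₁` must be red-reached (else its zone, a blue... ) — determine: zone M q₁ ∋ k₀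
    have hq₁r : (openGraph (M ∩ E)).Reachable s q₁ := by
      rcases hq₁M with h | h
      · exact h
      · exfalso
        have : k₀ ∈ openCluster (M ∩ E) q₁ := by rw [← zone_of_blue (hM q₁ hq₁R) h, hZM₁]; exact hk₀Z₁
        exact not_reachable_of_mem_openCluster _ this (fun h' => hM q₁ hq₁R ⟨h', h⟩) (g1 hskM)
    have hC : openCluster (Mᶜ ∩ E) q₁ = zone E s k₀ R T q₁ := by rw [← zone_of_red (hM q₁ hq₁R) hq₁r, hZM₁]
    have hrC : r ∈ openCluster (Mᶜ ∩ E) q₁ := by rw [hC]; exact hrZ₁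
    have hrnb : ¬ (openGraph (Mᶜ ∩ E)).Reachable s r := not_reachable_of_mem_openCluster _ hrC fun h => hM q₁ hq₁R ⟨hq₁r, h⟩
    have hskT : s(s, k₀) ∈ T := hsk_iff.1 hskM
    by_cases hrM : (openGraph (M ∩ E)).Reachable s r
    · refine ⟨by rw [zone_of_red (hM r hrR) hrM, openCluster_eq_of_mem _ hrC, hC, hZ₁, hZr], ?_⟩
      exact iff_of_true (beta_of_red hrM) (hβT.2 hskT)
    · have hswM : M ∈ swSet E s k₀ R := ⟨q₁, hq₁R, Or.inl hq₁r, by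
        rw [hub_of_red hskM, openCluster_eq_of_mem _ (show k₀ ∈ openCluster (Mᶜ ∩ E) q₁ by rw [hC]; exact hk₀Z₁)]
        exact mem_openCluster_self _ _⟩
      have hhub : hub E s k₀ M = hub E s k₀ T := by
        rw [hub_of_red hskM, openCluster_eq_of_mem _ (show k₀ ∈ openCluster (Mᶜ ∩ E) q₁ by rw [hC]; exact hk₀Z₁), hC, hZ₁]
      refine ⟨by rw [zone_of_sw hk huniv hrM hrnb hswM, hhub, hZr], ?_⟩
      rw [beta_iff_of_none hrM hrnb, hβT]
      exact iff_of_true (iff_of_true hswM hskM) hskT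
  · have hq₁b : (openGraph (Mᶜ ∩ E)).Reachable s q₁ := by
      rcases hq₁M with h | h
      · exfalso
        have : k₀ ∈ openCluster (Mᶜ ∩ E) q₁ := by rw [← zone_of_red (hM q₁ hq₁R) h, hZM₁]; exact hk₀Z₁
        exact not_reachable_of_mem_openCluster _ this (fun h' => hM q₁ hq₁R ⟨h, h'⟩) (g2 hskM)
      · exact h
    have hC : openCluster (M ∩ E) q₁ = zone E s k₀ R T q₁ := by rw [← zone_of_blue (hM q₁ hq₁R) hq₁b, hZM₁]
    have hrC : r ∈ openCluster (M ∩ E) q₁ := by rw [hC]; exact hrZ₁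
    have hrnr : ¬ (openGraph (M ∩ E)).Reachable s r := not_reachable_of_mem_openCluster _ hrC fun h => hM q₁ hq₁R ⟨h, hq₁b⟩
    have hskT : s(s, k₀) ∉ T := fun h => hskM (hsk_iff.2 h)
    by_cases hbM : (openGraph (Mᶜ ∩ E)).Reachable s r
    · refine ⟨by rw [zone_of_blue (hM r hrR) hbM, openCluster_eq_of_mem _ hrC, hC, hZ₁, hZr], ?_⟩
      exact iff_of_false (not_beta_of_blue (hM r hrR) hbM) (fun h => hskT (hβT.1 h))
    · have hk₀C : k₀ ∈ openCluster (M ∩ E) q₁ := by rw [hC]; exact hk₀Z₁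
      have hswM : M ∈ swSet E s k₀ R := ⟨q₁, hq₁R, Or.inr hq₁b, by
        rw [hub_of_blue hskM, openCluster_eq_of_mem _ hk₀C]; exact mem_openCluster_self _ _⟩
      have hhub : hub E s k₀ M = hub E s k₀ T := by rw [hub_of_blue hskM, openCluster_eq_of_mem _ hk₀C, hC, hZ₁]
      refine ⟨by rw [zone_of_sw hk huniv hrnr hbM hswM, hhub, hZr], ?_⟩
      rw [beta_iff_of_none hrnr hbM, hβT]
      exact iff_of_false (fun h => hskM (h.1 hswM)) hskT

/-- **No swallowing (case C)**: `T` not swallowing, some `r` unreached in `M`, the spoke `s k₀` of the same colour in `M` and `T`, and `M`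
agreeing with `T` or `Tᶜ` on every block ⇒ `M` is not swallowing. [this work] -/
theorem not_sw_small (hk : k₀ ≠ s) (huniv : ∀ v, v ≠ k₀ → s(k₀, v) ∈ E)
    (hT : ∀ r ∈ R, ¬ ((openGraph (T ∩ E)).Reachable s r ∧ (openGraph (Tᶜ ∩ E)).Reachable s r))
    (hM : ∀ r ∈ R, ¬ ((openGraph (M ∩ E)).Reachable s r ∧ (openGraph (Mᶜ ∩ E)).Reachable s r))
    (hag : ∀ u ∈ R, (∀ e ∈ ZoneSys.blk E (zone E s k₀ R T u), (e ∈ M ↔ e ∈ T)) ∨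
      (∀ e ∈ ZoneSys.blk E (zone E s k₀ R T u), (e ∈ M ↔ e ∉ T)))
    {r : V} (hswT : T ∉ swSet E s k₀ R) (hrM : ¬ (openGraph (M ∩ E)).Reachable s r) (hbM : ¬ (openGraph (Mᶜ ∩ E)).Reachable s r)
    (hc : s(s, k₀) ∈ M ↔ s(s, k₀) ∈ T) : M ∉ swSet E s k₀ R := by
  rintro ⟨q, hqR, hqM, hqh⟩
  have hrh : r ∈ hub E s k₀ M := mem_hub hk huniv hrM hbM
  obtain ⟨hn1M, hn2M⟩ := hub_not_reached hk huniv hrM hbM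
  obtain ⟨g1T, g2T⟩ := hubv_reached (T := T) hk huniv
  -- `q` is reached in `M` in the colour `c₀(M)` (the hub is not `c̄₀`-reached)
  by_cases hqT : (openGraph (T ∩ E)).Reachable s q ∨ (openGraph (Tᶜ ∩ E)).Reachable s q
  · -- `q` standard in `T`: its invariant zone contains `k₀`, so it is the hub of `T`, which then contains the reached `q`
    obtain ⟨hz, -⟩ := std_inv hk huniv (hT q hqR) (hM q hqR) hqT (hag q hqR)
    have hzM := hz hqM
    apply hswT
    refine ⟨q, hqR, hqT, ?_⟩
    by_cases hskM : s(s, k₀) ∈ M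
    · have hskT := hc.1 hskM
      rw [hub_of_red hskM] at hqh hrh
      have hqnb : ¬ (openGraph (Mᶜ ∩ E)).Reachable s q := not_reachable_of_mem_openCluster _ hqh (hn1M hskM)
      have hqr : (openGraph (M ∩ E)).Reachable s q := hqM.resolve_right hqnb
      rw [zone_of_red (hM q hqR) hqr, openCluster_eq_of_mem _ hqh] at hzM   -- hzM : openCluster (Mᶜ∩E) k₀ = zone T q
      -- zone T q ∋ k₀, and k₀ is red-reached in T: so q is red-reached in T and zone T q = blue cluster of q ∋ k₀
      have hk₀z : k₀ ∈ zone E s k₀ R T q := by rw [← hzM]; exact mem_openCluster_self _ _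
      rcases hqT with h | h
      · rw [zone_of_red (hT q hqR) h] at hk₀z
        rw [hub_of_red hskT, openCluster_eq_of_mem _ hk₀z]
        exact mem_openCluster_self _ _
      · rw [zone_of_blue (hT q hqR) h] at hk₀z
        exact absurd (g1T hskT) (not_reachable_of_mem_openCluster _ hk₀z fun h' => hT q hqR ⟨h', h⟩)
    · have hskT : s(s, k₀) ∉ T := fun h => hskM (hc.2 h)
      rw [hub_of_blue hskM] at hqh hrh
      have hqnr : ¬ (openGraph (M ∩ E)).Reachable s q := not_reachable_of_mem_openCluster _ hqh (hn2M hskM)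
      have hqb : (openGraph (Mᶜ ∩ E)).Reachable s q := hqM.resolve_left hqnr
      rw [zone_of_blue (hM q hqR) hqb, openCluster_eq_of_mem _ hqh] at hzM
      have hk₀z : k₀ ∈ zone E s k₀ R T q := by rw [← hzM]; exact mem_openCluster_self _ _
      rcases hqT with h | h
      · rw [zone_of_red (hT q hqR) h] at hk₀z
        exact absurd (g2T hskT) (not_reachable_of_mem_openCluster _ hk₀z fun h' => hT q hqR ⟨h, h'⟩)
      · rw [zone_of_blue (hT q hqR) h] at hk₀z
        rw [hub_of_blue hskT, openCluster_eq_of_mem _ hk₀z]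
        exact mem_openCluster_self _ _
  · -- `q` unreached in `T`, unswallowed (as `T ∉ swSet`): its own cluster is unreached in `T` and congruent in `M`
    rw [not_or] at hqT
    have hZq := zone_of_small hqT.1 hqT.2 hswT
    have hk₀own : k₀ ∉ own E s k₀ T q := fun h => by
      obtain ⟨h1, h2⟩ := own_unreached hk huniv hqT.1 hqT.2 h
      by_cases hsT : s(s, k₀) ∈ T
      · exact h1 (g1T hsT)
      · exact h2 (g2T hsT)
    -- cluster of `q` in `M` in the colour `c₀(M)` must contain `k₀` (it is the hub's cluster) or miss `s` — analyse
    by_cases hskM : s(s, k₀) ∈ M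
    · have hskT := hc.1 hskM
      rw [hub_of_red hskM] at hqh
      have hqnb : ¬ (openGraph (Mᶜ ∩ E)).Reachable s q := not_reachable_of_mem_openCluster _ hqh (hn1M hskM)
      have hqr : (openGraph (M ∩ E)).Reachable s q := hqM.resolve_right hqnb
      rw [own_of_red hskT] at hZq hk₀own
      rcases hag q hqR with ha | ha
      · -- M = T on the block: red cluster of q unchanged, misses s — but q red-reached in M
        have hcq : openCluster (M ∩ E) q = openCluster (T ∩ E) q := by
          refine openCluster_eq_of_agree' (T ∩ E) (M ∩ E) q fun x hx y hxy => ?_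
          by_cases hxyE : s(x, y) ∈ E
          · have := ha _ (by rw [hZq]; exact ZoneSys.mk_mem_blk hxyE hxy (Or.inl hx))
            simp only [Set.mem_inter_iff, hxyE, and_true, this]
          · simp only [Set.mem_inter_iff, hxyE, and_false]
        have : s ∈ openCluster (M ∩ E) q := hqr.symm
        rw [hcq] at this
        exact hqT.1 (show (openGraph (T ∩ E)).Reachable q s from this).symm
      · -- M = Tᶜ on the block: blue M-cluster of q = red T-cluster of q ∋ ... = hub-cluster of k₀ in M ∋ k₀
        have hcq : openCluster (Mᶜ ∩ E) q = openCluster (T ∩ E) q := by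
          refine openCluster_eq_of_agree' (T ∩ E) (Mᶜ ∩ E) q fun x hx y hxy => ?_
          by_cases hxyE : s(x, y) ∈ E
          · have := ha _ (by rw [hZq]; exact ZoneSys.mk_mem_blk hxyE hxy (Or.inl hx))
            simp only [Set.mem_inter_iff, Set.mem_compl_iff, hxyE, and_true, this, not_not]
          · simp only [Set.mem_inter_iff, hxyE, and_false]
        apply hk₀own
        rw [← hcq, openCluster_eq_of_mem _ hqh]
        exact mem_openCluster_self _ _
    · have hskT : s(s, k₀) ∉ T := fun h => hskM (hc.2 h)
      rw [hub_of_blue hskM] at hqh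
      have hqnr : ¬ (openGraph (M ∩ E)).Reachable s q := not_reachable_of_mem_openCluster _ hqh (hn2M hskM)
      have hqb : (openGraph (Mᶜ ∩ E)).Reachable s q := hqM.resolve_left hqnr
      rw [own_of_blue hskT] at hZq hk₀own
      rcases hag q hqR with ha | ha
      · have hcq : openCluster (Mᶜ ∩ E) q = openCluster (Tᶜ ∩ E) q := by
          refine openCluster_eq_of_agree' (Tᶜ ∩ E) (Mᶜ ∩ E) q fun x hx y hxy => ?_
          by_cases hxyE : s(x, y) ∈ E
          · have := ha _ (by rw [hZq]; exact ZoneSys.mk_mem_blk hxyE hxy (Or.inl hx))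
            simp only [Set.mem_inter_iff, Set.mem_compl_iff, hxyE, and_true, this]
          · simp only [Set.mem_inter_iff, hxyE, and_false]
        have : s ∈ openCluster (Mᶜ ∩ E) q := hqb.symm
        rw [hcq] at this
        exact hqT.2 (show (openGraph (Tᶜ ∩ E)).Reachable q s from this).symm
      · have hcq : openCluster (M ∩ E) q = openCluster (Tᶜ ∩ E) q := by
          refine openCluster_eq_of_agree' (Tᶜ ∩ E) (M ∩ E) q fun x hx y hxy => ?_
          by_cases hxyE : s(x, y) ∈ E
          · have := ha _ (by rw [hZq]; exact ZoneSys.mk_mem_blk hxyE hxy (Or.inl hx))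
            simp only [Set.mem_inter_iff, Set.mem_compl_iff, hxyE, and_true, this]
          · simp only [Set.mem_inter_iff, hxyE, and_false]
        apply hk₀own
        rw [← hcq, openCluster_eq_of_mem _ hqh]
        exact mem_openCluster_self _ _

/-- **Case C: invariance for an unreached, unswallowed vertex** (agreement with `T` on its block). [this work] -/
theorem inv_small (hk : k₀ ≠ s) (huniv : ∀ v, v ≠ k₀ → s(k₀, v) ∈ E)
    (hT : ∀ r ∈ R, ¬ ((openGraph (T ∩ E)).Reachable s r ∧ (openGraph (Tᶜ ∩ E)).Reachable s r))
    (hM : ∀ r ∈ R, ¬ ((openGraph (M ∩ E)).Reachable s r ∧ (openGraph (Mᶜ ∩ E)).Reachable s r))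
    (hag : ∀ u ∈ R, (∀ e ∈ ZoneSys.blk E (zone E s k₀ R T u), (e ∈ M ↔ e ∈ T)) ∨
      (∀ e ∈ ZoneSys.blk E (zone E s k₀ R T u), (e ∈ M ↔ e ∉ T)))
    {r : V} (hrR : r ∈ R) (hr : ¬ (openGraph (T ∩ E)).Reachable s r) (hb : ¬ (openGraph (Tᶜ ∩ E)).Reachable s r)
    (hswT : T ∉ swSet E s k₀ R) (hagr : ∀ e ∈ ZoneSys.blk E (zone E s k₀ R T r), (e ∈ M ↔ e ∈ T)) :
    zone E s k₀ R M r = zone E s k₀ R T r ∧ (r ∈ beta E s k₀ R M ↔ r ∈ beta E s k₀ R T) := by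
  have hZ := zone_of_small hr hb hswT
  have hβT : r ∈ beta E s k₀ R T ↔ s(s, k₀) ∉ T := by
    rw [beta_iff_of_none hr hb]; exact ⟨fun h h' => hswT (h.2 h'), fun h => iff_of_false hswT h⟩
  obtain ⟨hrk, hE, hiffT⟩ := opp_spoke hk huniv hr hb
  have hrkb : s(r, k₀) ∈ ZoneSys.blk E (zone E s k₀ R T r) := ZoneSys.mk_mem_blk hE hrk (Or.inl mem_zone_self)
  have hrk_iff : s(r, k₀) ∈ M ↔ s(r, k₀) ∈ T := hagr _ hrkb
  rw [hZ]
  by_cases hsT : s(s, k₀) ∈ T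
  · -- own = red cluster of r, congruent in M
    rw [own_of_red hsT] at hZ ⊢
    have hcq : openCluster (M ∩ E) r = openCluster (T ∩ E) r := by
      refine openCluster_eq_of_agree' (T ∩ E) (M ∩ E) r fun x hx y hxy => ?_
      by_cases hxyE : s(x, y) ∈ E
      · have := hagr _ (by rw [hZ]; exact ZoneSys.mk_mem_blk hxyE hxy (Or.inl hx))
        simp only [Set.mem_inter_iff, hxyE, and_true, this]
      · simp only [Set.mem_inter_iff, hxyE, and_false]
    have hrnr : ¬ (openGraph (M ∩ E)).Reachable s r := fun h => by
      have : s ∈ openCluster (M ∩ E) r := h.symm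
      rw [hcq] at this
      exact hr (show (openGraph (T ∩ E)).Reachable r s from this).symm
    by_cases hbM : (openGraph (Mᶜ ∩ E)).Reachable s r
    · refine ⟨by rw [zone_of_blue (hM r hrR) hbM, hcq], ?_⟩
      exact iff_of_false (not_beta_of_blue (hM r hrR) hbM) (fun h => (hβT.1 h) hsT)
    · obtain ⟨-, -, hiffM⟩ := opp_spoke (T := M) hk huniv hrnr hbM
      have hskM : s(s, k₀) ∈ M := by
        by_contra hM'
        exact (hiffT.1 (hrk_iff.1 (hiffM.2 hM'))) hsT
      have hc : s(s, k₀) ∈ M ↔ s(s, k₀) ∈ T := iff_of_true hskM hsT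
      have hswM := not_sw_small hk huniv hT hM hag hswT hrnr hbM hc
      refine ⟨by rw [zone_of_small hrnr hbM hswM, own_of_red hskM, hcq], ?_⟩
      rw [beta_iff_of_none hrnr hbM]
      exact iff_of_false (fun h => hswM (h.2 hskM)) (fun h => (hβT.1 h) hsT)
  · rw [own_of_blue hsT] at hZ ⊢
    have hcq : openCluster (Mᶜ ∩ E) r = openCluster (Tᶜ ∩ E) r := by
      refine openCluster_eq_of_agree' (Tᶜ ∩ E) (Mᶜ ∩ E) r fun x hx y hxy => ?_
      by_cases hxyE : s(x, y) ∈ E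
      · have := hagr _ (by rw [hZ]; exact ZoneSys.mk_mem_blk hxyE hxy (Or.inl hx))
        simp only [Set.mem_inter_iff, Set.mem_compl_iff, hxyE, and_true, this]
      · simp only [Set.mem_inter_iff, hxyE, and_false]
    have hrnb : ¬ (openGraph (Mᶜ ∩ E)).Reachable s r := fun h => by
      have : s ∈ openCluster (Mᶜ ∩ E) r := h.symm
      rw [hcq] at this
      exact hb (show (openGraph (Tᶜ ∩ E)).Reachable r s from this).symm
    by_cases hrM : (openGraph (M ∩ E)).Reachable s r
    · refine ⟨by rw [zone_of_red (hM r hrR) hrM, hcq], ?_⟩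
      exact iff_of_true (beta_of_red hrM) (hβT.2 hsT)
    · obtain ⟨-, -, hiffM⟩ := opp_spoke (T := M) hk huniv hrM hrnb
      have hskM : s(s, k₀) ∉ M := fun hM' => (hiffM.1 (hrk_iff.2 (hiffT.2 hsT))) hM'
      have hc : s(s, k₀) ∈ M ↔ s(s, k₀) ∈ T := iff_of_false hskM hsT
      have hswM := not_sw_small hk huniv hT hM hag hswT hrM hrnb hc
      refine ⟨by rw [zone_of_small hrM hrnb hswM, own_of_blue hskM, hcq], ?_⟩
      rw [beta_iff_of_none hrM hrnb]
      exact iff_of_true (iff_of_false hswM hskM) (hβT.2 hsT)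

/-- **Invariance, agreement with `T`** (all types of `r`). [this work] -/
theorem inv_core (hk : k₀ ≠ s) (huniv : ∀ v, v ≠ k₀ → s(k₀, v) ∈ E)
    (hT : ∀ r ∈ R, ¬ ((openGraph (T ∩ E)).Reachable s r ∧ (openGraph (Tᶜ ∩ E)).Reachable s r))
    (hM : ∀ r ∈ R, ¬ ((openGraph (M ∩ E)).Reachable s r ∧ (openGraph (Mᶜ ∩ E)).Reachable s r))
    (hag : ∀ u ∈ R, (∀ e ∈ ZoneSys.blk E (zone E s k₀ R T u), (e ∈ M ↔ e ∈ T)) ∨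
      (∀ e ∈ ZoneSys.blk E (zone E s k₀ R T u), (e ∈ M ↔ e ∉ T)))
    {r : V} (hrR : r ∈ R) (hagr : ∀ e ∈ ZoneSys.blk E (zone E s k₀ R T r), (e ∈ M ↔ e ∈ T)) :
    zone E s k₀ R M r = zone E s k₀ R T r ∧ (r ∈ beta E s k₀ R M ↔ r ∈ beta E s k₀ R T) := by
  by_cases hr : (openGraph (T ∩ E)).Reachable s r
  · obtain ⟨hz, hβ⟩ := inv_red hk huniv hT hM hag hrR hr hagr
    exact ⟨hz, iff_of_true hβ (beta_of_red hr)⟩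
  · by_cases hb : (openGraph (Tᶜ ∩ E)).Reachable s r
    · have hagr' : ∀ e ∈ ZoneSys.blk E (zone E s k₀ R Tᶜ r), (e ∈ Mᶜ ↔ e ∈ Tᶜ) := by
        rw [zone_compl]; exact ACone.agree_compl_both hagr
      obtain ⟨hz, hβ⟩ := inv_red (T := Tᶜ) (M := Mᶜ) hk huniv (constraint_compl hT) (constraint_compl hM) (agree_all_compl hag)
        hrR hb hagr'
      rw [zone_compl, zone_compl] at hz
      rw [beta_compl (hM r hrR)] at hβ
      exact ⟨hz, iff_of_false hβ (not_beta_of_blue (hT r hrR) hb)⟩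
    · by_cases hsw : T ∈ swSet E s k₀ R
      · exact inv_sw hk huniv hT hM hrR hr hb hsw hagr
      · exact inv_small hk huniv hT hM hag hrR hr hb hsw hagr

/-- **Invariance of the zone system of THEOREM U** (hypothesis (invariance) of `zoneSystem_bic_nonneg`). [this work] -/
theorem invariance (hk : k₀ ≠ s) (huniv : ∀ v, v ≠ k₀ → s(k₀, v) ∈ E)
    (hT : ∀ r ∈ R, ¬ ((openGraph (T ∩ E)).Reachable s r ∧ (openGraph (Tᶜ ∩ E)).Reachable s r))
    (hM : ∀ r ∈ R, ¬ ((openGraph (M ∩ E)).Reachable s r ∧ (openGraph (Mᶜ ∩ E)).Reachable s r))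
    (hag : ∀ u ∈ R, (∀ e ∈ ZoneSys.blk E (zone E s k₀ R T u), (e ∈ M ↔ e ∈ T)) ∨
      (∀ e ∈ ZoneSys.blk E (zone E s k₀ R T u), (e ∈ M ↔ e ∉ T))) :
    ∀ u ∈ R, zone E s k₀ R M u = zone E s k₀ R T u ∧
      (((∀ e ∈ ZoneSys.blk E (zone E s k₀ R T u), (e ∈ M ↔ e ∈ T)) ∧ (u ∈ beta E s k₀ R M ↔ u ∈ beta E s k₀ R T)) ∨
        ((∀ e ∈ ZoneSys.blk E (zone E s k₀ R T u), (e ∈ M ↔ e ∉ T)) ∧ (u ∈ beta E s k₀ R M ↔ u ∉ beta E s k₀ R T))) := by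
  intro u hu
  rcases hag u hu with h | h
  · obtain ⟨hz, hβ⟩ := inv_core hk huniv hT hM hag hu h
    exact ⟨hz, Or.inl ⟨h, hβ⟩⟩
  · obtain ⟨hz, hβ⟩ := inv_core (M := Mᶜ) hk huniv hT (constraint_compl hM) (agree_all_compl_right hag) hu (ACone.agree_compl_left h)
    rw [zone_compl] at hz
    rw [beta_compl (hM u hu)] at hβ
    exact ⟨hz, Or.inr ⟨h, by rw [← hβ, not_not]⟩⟩

end Invariance

end UCone

end Antithetic

end Summit.CriticalPhenomena.PercolationContinuityZ3.Theorems
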